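import Literature.NumberTheory.Transcendental.ChartTransfer
import Literature.NumberTheory.Transcendental.ExpVarietiesDimension
import HarnessLib

/-!
# Transfer of the axiom-4 data of a variety to an algebraically closed subfield of definition

Let `M ⊆ F` be algebraically closed fields (`Algebra M F`) and `W ⊆ F^{n ⊕ n}` a closed set cut
out by polynomials with coefficients in `M`, `W = Z_F(G)` with `G ⊆ M[X, Y]`. Writing
`P = I_F(W)` and `J = P ∩ M[X, Y]` (`ChartTransfer.contract P`), the `M`-points
`W_M = Z_M(J) = {m | m ∈ W}` of `W` form a closed subset of `M^{n ⊕ n}` to which the hypotheses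
of Bays–Kirby's axiom 4 descend: irreducibility (`I_M(W_M) = J` is prime, Nullstellensatz),
dimension (`ChartTransfer.trdeg_quotient_contract_eq` and `dim = trdeg`), non-emptiness of
the intersection with the torus, additive and multiplicative freeness, and rotundity. This is
the variety half of "axiom 4 is preserved under directed unions of closed embeddings"
(Bays–Kirby 2018, proof of Thm 8.2), used for the continuum model in `ContinuumModel.lean`.

## References

* M. Bays, J. Kirby, *Pseudo-exponential maps, variants, and quasiminimality*, Algebra & Number
  Theory 12 (2018), Thm 8.2 (proof).
-/

noncomputable section

open MvPolynomial Set

universe u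

namespace Literature.NumberTheory.Transcendental.ChartTransfer

variable {M F : Type u} [Field M] [Field F] [Algebra M F] {σ : Type*}

/-! ### The `M`-points of a closed set defined over `M` -/

section Points

variable {W : Set (σ → F)} {G : Set (MvPolynomial σ M)}

/-- Polynomials over `M` cutting out `W` lie in the contraction of `I_F(W)`. [folklore] -/
theorem subset_contract_vanishingIdeal (hWG : W = zeroLocus F (Ideal.span G)) :
    G ⊆ contract (M := M) (vanishingIdeal F W) := by
  intro g hg
  rw [SetLike.mem_coe, mem_contract_iff, mem_vanishingIdeal_iff]
  intro x hx
  rw [hWG, zeroLocus_span] at hx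
  rw [aeval_map_algebraMap]
  exact hx g hg

/-- `W = Z_F(I_F(W))` for a zero locus `W`. [folklore] -/
theorem zeroLocus_vanishingIdeal_eq (hWG : W = zeroLocus F (Ideal.span G)) :
    zeroLocus F (vanishingIdeal F W) = W := by
  refine Subset.antisymm ?_ (zeroLocus_vanishingIdeal_le W)
  intro x hx
  rw [hWG, zeroLocus_span]
  intro g hg
  have := hx _ (mem_contract_iff.1 (subset_contract_vanishingIdeal hWG hg))
  rwa [aeval_map_algebraMap] at this

/-- **The `M`-points of the contraction are the `M`-points of `W`.** [folklore] -/
theorem mem_zeroLocus_contract_iff (hWG : W = zeroLocus F (Ideal.span G)) (m : σ → M) :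
    m ∈ zeroLocus M (contract (M := M) (vanishingIdeal F W)) ↔ (algebraMap M F ∘ m) ∈ W := by
  constructor
  · intro hm
    rw [hWG, zeroLocus_span]
    intro g hg
    rw [aeval_algebraMap_comp, hm g (subset_contract_vanishingIdeal hWG hg), map_zero]
  · intro hm q hq
    have h1 : aeval (algebraMap M F ∘ m) (MvPolynomial.map (algebraMap M F) q) = 0 := by
      rw [← zeroLocus_vanishingIdeal_eq hWG] at hm
      exact hm _ (mem_contract_iff.1 hq)
    rw [aeval_map_algebraMap, aeval_algebraMap_comp] at h1
    exact (map_eq_zero_iff _ (algebraMap M F).injective).1 h1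

/-- The point hypothesis of `ChartTransfer.algebraicIndependent_quotientMap` holds for the
contraction of `I_F(W)`, `W` defined over `M`. [folklore] -/
theorem pts_of_definedOver (hWG : W = zeroLocus F (Ideal.span G)) :
    ∀ m : σ → M, m ∈ zeroLocus M (contract (M := M) (vanishingIdeal F W)) →
      (algebraMap M F ∘ m) ∈ zeroLocus F (vanishingIdeal F W) := by
  intro m hm
  rw [zeroLocus_vanishingIdeal_eq hWG]
  exact (mem_zeroLocus_contract_iff hWG m).1 hm

end Points

/-! ### Irreducibility and dimension descend -/

section Irreducible

variable [IsAlgClosed M] [IsAlgClosed F] [Finite σ] {W : Set (σ → F)} {G : Set (MvPolynomial σ M)}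

omit [IsAlgClosed F] in
/-- The `M`-points of an irreducible closed set defined over `M` form an irreducible closed set,
whose vanishing ideal is the contraction of `I_F(W)`. [cite: BaysKirby2018ANT, Thm 8.2 (proof)] -/
theorem isIrreducibleClosed_zeroLocus_contract (hW : IsIrreducibleClosed F W) :
    IsIrreducibleClosed M (zeroLocus M (contract (M := M) (vanishingIdeal F W))) := by
  haveI : (vanishingIdeal F W).IsPrime := hW.2
  refine ⟨⟨_, rfl⟩, ?_⟩
  rw [MvPolynomial.IsPrime.vanishingIdeal_zeroLocus (K := M)]
  infer_instance

/-- **The dimension descends**: `dim_M W_M = dim_F W` for `W` irreducible closed defined over `M`.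
[cite: BaysKirby2018ANT, Thm 8.2 (proof)] -/
theorem zariskiDim_zeroLocus_contract {n : ℕ} {W : Set (Fin n ⊕ Fin n → F)}
    {G : Set (MvPolynomial (Fin n ⊕ Fin n) M)} (hW : IsIrreducibleClosed F W)
    (hWG : W = zeroLocus F (Ideal.span G)) :
    zariskiDim M (zeroLocus M (contract (M := M) (vanishingIdeal F W))) = zariskiDim F W := by
  haveI : (vanishingIdeal F W).IsPrime := hW.2
  conv_rhs => rw [← zeroLocus_vanishingIdeal_eq hWG]
  rw [zariskiDim_zeroLocus_eq_trdeg, zariskiDim_zeroLocus_eq_trdeg,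
    trdeg_quotient_contract_eq _ (pts_of_definedOver hWG)]

end Irreducible

/-! ### The torus, non-emptiness, and the exponential graph -/

section Torus

variable {n : ℕ} {W : Set (Fin n ⊕ Fin n → F)} {G : Set (MvPolynomial (Fin n ⊕ Fin n) M)}

/-- `M`-points of the torus. [folklore] -/
theorem comp_mem_torusLocus_iff (m : Fin n ⊕ Fin n → M) :
    (algebraMap M F ∘ m) ∈ torusLocus F n ↔ m ∈ torusLocus M n := by
  simp only [mem_torusLocus_iff, Function.comp_apply, map_ne_zero_iff _ (algebraMap M F).injective]

variable [IsAlgClosed M] [Finite (Fin n ⊕ Fin n)]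

/-- A polynomial over `M` vanishing on the `M`-points `W_M` vanishes on `W`. [folklore] -/
theorem aeval_eq_zero_of_forall_zeroLocus_contract (hW : IsIrreducibleClosed F W)
    {q : MvPolynomial (Fin n ⊕ Fin n) M}
    (hq : ∀ m ∈ zeroLocus M (contract (M := M) (vanishingIdeal F W)), aeval m q = 0)
    {x : Fin n ⊕ Fin n → F} (hx : x ∈ W) : aeval x q = 0 := by
  haveI : (vanishingIdeal F W).IsPrime := hW.2
  have hqJ : q ∈ vanishingIdeal M (zeroLocus M (contract (M := M) (vanishingIdeal F W))) :=
    fun m hm => hq m hm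
  rw [MvPolynomial.IsPrime.vanishingIdeal_zeroLocus (K := M)] at hqJ
  have := (mem_contract_iff.1 hqJ)
  rw [mem_vanishingIdeal_iff] at this
  have h := this x hx
  rwa [aeval_map_algebraMap] at h

/-- **Non-emptiness of the intersection with the torus descends.**
[cite: BaysKirby2018ANT, Thm 8.2 (proof)] -/
theorem nonempty_zeroLocus_contract_inter_torus (hW : IsIrreducibleClosed F W)
    (hne : (W ∩ torusLocus F n).Nonempty) :
    (zeroLocus M (contract (M := M) (vanishingIdeal F W)) ∩ torusLocus M n).Nonempty := by
  classical
  by_contra hempty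
  rw [not_nonempty_iff_eq_empty] at hempty
  -- `∏ Y_j` vanishes on `W_M`, hence on `W`
  set q : MvPolynomial (Fin n ⊕ Fin n) M := ∏ j, X (Sum.inr j) with hqdef
  have hq : ∀ m ∈ zeroLocus M (contract (M := M) (vanishingIdeal F W)), aeval m q = 0 := by
    intro m hm
    have hmT : m ∉ torusLocus M n := fun hT =>
      (eq_empty_iff_forall_notMem.1 hempty) m ⟨hm, hT⟩
    simp only [mem_torusLocus_iff, not_forall, not_not] at hmT
    obtain ⟨j, hj⟩ := hmT
    rw [hqdef, map_prod]
    exact Finset.prod_eq_zero (Finset.mem_univ j) (by simp [hj])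
  obtain ⟨x, hxW, hxT⟩ := hne
  have h0 := aeval_eq_zero_of_forall_zeroLocus_contract hW hq hxW
  rw [hqdef, map_prod] at h0
  obtain ⟨j, -, hj⟩ := Finset.prod_eq_zero_iff.1 h0
  exact hxT j (by simpa using hj)

end Torus

/-! ### Freeness descends -/

section Free

variable {n : ℕ} {W : Set (Fin n ⊕ Fin n → F)}

omit [Algebra M F] in
/-- Splitting an integer exponent vector into its positive and negative parts on the torus:
`∏ yᵢ ^ mᵢ = (∏ yᵢ ^ mᵢ⁺) / (∏ yᵢ ^ mᵢ⁻)`. [folklore] -/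
theorem prod_zpow_eq_div {K : Type*} [Field K] (y : Fin n → K) (hy : ∀ i, y i ≠ 0)
    (m : Fin n → ℤ) :
    ∏ i, y i ^ m i = (∏ i, y i ^ (m i).toNat) / ∏ i, y i ^ (-m i).toNat := by
  rw [← Finset.prod_div_distrib]
  refine Finset.prod_congr rfl fun i _ => ?_
  rw [← zpow_natCast, ← zpow_natCast, ← zpow_sub₀ (hy i)]
  congr 1
  have := Int.toNat_sub_toNat_neg (m i)
  omega

variable [IsAlgClosed M] [Finite (Fin n ⊕ Fin n)]

/-- **Additive freeness descends** to the `M`-points. [cite: BaysKirby2018ANT, Thm 8.2 (proof)] -/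
theorem isAddFree_zeroLocus_contract (hW : IsIrreducibleClosed F W)
    (hfree : IsAddFree F n (W ∩ torusLocus F n)) :
    IsAddFree M n (zeroLocus M (contract (M := M) (vanishingIdeal F W)) ∩ torusLocus M n) := by
  classical
  rintro m hm ⟨c, hc⟩
  -- the polynomial `(∑ mᵢ Xᵢ - c) · ∏ Yⱼ` vanishes on `W_M`
  set q : MvPolynomial (Fin n ⊕ Fin n) M :=
    (∑ i, C (m i : M) * X (Sum.inl i) - C c) * ∏ j, X (Sum.inr j) with hqdef
  have hq : ∀ z ∈ zeroLocus M (contract (M := M) (vanishingIdeal F W)), aeval z q = 0 := by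
    intro z hz
    rw [hqdef, map_mul]
    by_cases hzT : z ∈ torusLocus M n
    · have := hc z ⟨hz, hzT⟩
      rw [map_sub, map_sum]
      simp only [map_mul, aeval_C, aeval_X, Algebra.algebraMap_self_apply] at this ⊢
      rw [this, sub_self, zero_mul]
    · simp only [mem_torusLocus_iff, not_forall, not_not] at hzT
      obtain ⟨j, hj⟩ := hzT
      rw [map_prod, Finset.prod_eq_zero (Finset.mem_univ j) (by simp [hj]), mul_zero]
  refine hfree m hm ⟨algebraMap M F c, fun x hx => ?_⟩
  have h0 := aeval_eq_zero_of_forall_zeroLocus_contract hW hq hx.1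
  rw [hqdef, map_mul] at h0
  have hprod : aeval x (∏ j, X (Sum.inr j) : MvPolynomial (Fin n ⊕ Fin n) M) ≠ 0 := by
    rw [map_prod]
    exact Finset.prod_ne_zero_iff.2 fun j _ => by simpa using hx.2 j
  have h1 := (mul_eq_zero.1 h0).resolve_right hprod
  rw [map_sub, map_sum, sub_eq_zero] at h1
  simpa only [map_mul, aeval_C, aeval_X, map_intCast] using h1

/-- **Multiplicative freeness descends** to the `M`-points.
[cite: BaysKirby2018ANT, Thm 8.2 (proof)] -/
theorem isMulFree_zeroLocus_contract (hW : IsIrreducibleClosed F W)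
    (hfree : IsMulFree F n (W ∩ torusLocus F n)) :
    IsMulFree M n (zeroLocus M (contract (M := M) (vanishingIdeal F W)) ∩ torusLocus M n) := by
  classical
  rintro m hm ⟨c, hc⟩
  -- the polynomial `(∏ Yᵢ^{mᵢ⁺} - c ∏ Yᵢ^{mᵢ⁻}) · ∏ Yⱼ` vanishes on `W_M`
  set A : MvPolynomial (Fin n ⊕ Fin n) M := ∏ i, X (Sum.inr i) ^ (m i).toNat with hA
  set B : MvPolynomial (Fin n ⊕ Fin n) M := ∏ i, X (Sum.inr i) ^ (-m i).toNat with hB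
  set q : MvPolynomial (Fin n ⊕ Fin n) M := (A - C c * B) * ∏ j, X (Sum.inr j) with hqdef
  have hAeval : ∀ {K : Type u} [Field K] [Algebra M K] (z : Fin n ⊕ Fin n → K),
      aeval z A = ∏ i, z (Sum.inr i) ^ (m i).toNat := by
    intro K _ _ z; simp [hA, map_prod]
  have hBeval : ∀ {K : Type u} [Field K] [Algebra M K] (z : Fin n ⊕ Fin n → K),
      aeval z B = ∏ i, z (Sum.inr i) ^ (-m i).toNat := by
    intro K _ _ z; simp [hB, map_prod]
  have hq : ∀ z ∈ zeroLocus M (contract (M := M) (vanishingIdeal F W)), aeval z q = 0 := by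
    intro z hz
    rw [hqdef, map_mul]
    by_cases hzT : z ∈ torusLocus M n
    · have hzc := hc z ⟨hz, hzT⟩
      have hne : ∏ i, z (Sum.inr i) ^ (-m i).toNat ≠ 0 :=
        Finset.prod_ne_zero_iff.2 fun i _ => pow_ne_zero _ (hzT i)
      rw [prod_zpow_eq_div _ hzT, div_eq_iff hne] at hzc
      rw [map_sub, map_mul, aeval_C, hAeval, hBeval, Algebra.algebraMap_self_apply, hzc, sub_self,
        zero_mul]
    · simp only [mem_torusLocus_iff, not_forall, not_not] at hzT
      obtain ⟨j, hj⟩ := hzT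
      rw [map_prod, Finset.prod_eq_zero (Finset.mem_univ j) (by simp [hj]), mul_zero]
  refine hfree m hm ⟨algebraMap M F c, fun x hx => ?_⟩
  have h0 := aeval_eq_zero_of_forall_zeroLocus_contract hW hq hx.1
  rw [hqdef, map_mul] at h0
  have hprod : aeval x (∏ j, X (Sum.inr j) : MvPolynomial (Fin n ⊕ Fin n) M) ≠ 0 := by
    rw [map_prod]
    exact Finset.prod_ne_zero_iff.2 fun j _ => by simpa using hx.2 j
  have h1 := (mul_eq_zero.1 h0).resolve_right hprod
  rw [map_sub, map_mul, aeval_C, hAeval, hBeval, sub_eq_zero] at h1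
  have hne : ∏ i, x (Sum.inr i) ^ (-m i).toNat ≠ 0 :=
    Finset.prod_ne_zero_iff.2 fun i _ => pow_ne_zero _ (hx.2 i)
  rw [prod_zpow_eq_div _ hx.2, div_eq_iff hne, h1]

end Free

/-! ### Rotundity descends -/

section Rotund

variable {n : ℕ} {W : Set (Fin n ⊕ Fin n → F)} {G : Set (MvPolynomial (Fin n ⊕ Fin n) M)}
variable [IsAlgClosed M] [IsAlgClosed F]

omit [IsAlgClosed F] in
/-- In an affine domain generated by finitely many elements, `r ≤ trdeg` yields `r` algebraically
independent generators. [folklore] -/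
theorem exists_algebraicIndependent_of_le_trdeg {E : Type u} [Field E] [Algebra F E]
    {ι : Type*} [Finite ι] (pt : ι → E) {r : ℕ}
    (hr : (r : Cardinal) ≤ Algebra.trdeg F (Algebra.adjoin F (Set.range pt))) :
    ∃ j : Fin r → ι, AlgebraicIndependent F fun k => pt (j k) := by
  classical
  set R := Algebra.adjoin F (Set.range pt) with hR
  haveI : @FaithfulSMul F R Algebra.toSMul :=
    (faithfulSMul_iff_algebraMap_injective F R).mpr (algebraMap F R).injective
  -- generators of `R`
  let gen : ι → R := fun i => ⟨pt i, Algebra.subset_adjoin (Set.mem_range_self i)⟩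
  have hadj : Algebra.adjoin F (Set.range gen) = ⊤ := by
    refine Algebra.eq_top_iff.2 fun x => ?_
    have hx : (x : E) ∈ Algebra.adjoin F (Set.range pt) := x.2
    have hmap : Algebra.adjoin F (Set.range pt) = (Algebra.adjoin F (Set.range gen)).map R.val := by
      rw [AlgHom.map_adjoin, ← Set.range_comp]; rfl
    rw [hmap] at hx
    obtain ⟨y, hy, hyx⟩ := hx
    have : y = x := Subtype.ext hyx
    rwa [← this]
  haveI : Algebra.IsAlgebraic (Algebra.adjoin F (Set.range gen)) R :=
    ⟨fun b => by
      have hb : b ∈ Algebra.adjoin F (Set.range gen) := by rw [hadj]; exact Algebra.mem_top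
      exact isAlgebraic_algebraMap (⟨b, hb⟩ : Algebra.adjoin F (Set.range gen))⟩
  obtain ⟨t, hts, ht⟩ := exists_isTranscendenceBasis_subset (R := F) (Set.range gen)
  -- `t` is finite of cardinality `trdeg ≥ r`
  haveI : Finite t := (Set.finite_range gen).subset hts |>.to_subtype
  haveI := Fintype.ofFinite t
  have hcard : r ≤ Fintype.card t := by
    have h1 := ht.cardinalMk_eq_trdeg
    rw [Cardinal.mk_fintype] at h1
    have : (r : Cardinal) ≤ (Fintype.card t : Cardinal) := by rw [h1]; exact hr
    exact_mod_cast this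
  -- choose `r` elements of `t` and their indices
  let emb : Fin r ↪ t := (Fin.castLEEmb hcard).trans (Fintype.equivFin t).symm.toEmbedding
  have hpre : ∀ b : t, ∃ i : ι, gen i = b := fun b => hts b.2
  choose idx hidx using hpre
  refine ⟨fun k => idx (emb k), ?_⟩
  have h1 : AlgebraicIndependent F (((↑) : t → R) ∘ emb) := ht.1.comp _ emb.injective
  have h2 : AlgebraicIndependent F (R.val ∘ (((↑) : t → R) ∘ emb)) :=
    h1.map' Subtype.val_injective
  convert h2 using 1
  funext k
  simp only [Function.comp_apply]
  rw [← hidx (emb k)]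
  rfl

variable [Finite (Fin n ⊕ Fin n)]

/-- **Rotundity descends** to the `M`-points. [cite: BaysKirby2018ANT, Thm 8.2 (proof)] -/
theorem isRotund_zeroLocus_contract (hW : IsIrreducibleClosed F W)
    (hWG : W = zeroLocus F (Ideal.span G)) (hne : (W ∩ torusLocus F n).Nonempty)
    (hrot : IsRotund F n (W ∩ torusLocus F n)) :
    IsRotund M n (zeroLocus M (contract (M := M) (vanishingIdeal F W)) ∩ torusLocus M n) := by
  classical
  set P := vanishingIdeal F W with hP
  haveI : P.IsPrime := hW.2
  have hWP : zeroLocus F P = W := zeroLocus_vanishingIdeal_eq hWG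
  intro μ
  -- the generic point of `P`, as a point over `M` as well
  let E := zeroLocusFunctionField P
  let ξ : Fin n ⊕ Fin n → E := genericPt P
  have hξ : IsGenericPt P ξ := isGenericPt_genericPt P
  have hξM : IsGenericPt (contract (M := M) P) ξ := by
    intro a
    rw [← aeval_map_algebraMap F, hξ, mem_contract_iff]
  have hneF : (zeroLocus F P ∩ torusLocus F n).Nonempty := by rwa [hWP]
  have hneM := nonempty_zeroLocus_contract_inter_torus (M := M) hW hne
  -- the bound over `F`, read as `rank μ` algebraically independent coordinates of `[μ] ξ`
  have hF := hrot μ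
  rw [← hWP, zariskiDim_image_matrixAct_eq P hξ hneF μ] at hF
  set φ := (aeval (matrixAct μ ξ) : MvPolynomial (Fin n ⊕ Fin n) F →ₐ[F] E) with hφ
  haveI : Algebra.FiniteType F φ.range :=
    Algebra.FiniteType.of_surjective φ.rangeRestrict (AlgHom.rangeRestrict_surjective φ)
  set r := (μ.map (Int.cast : ℤ → ℚ)).rank with hr
  have hr' : (r : Cardinal) ≤ Algebra.trdeg F (Algebra.adjoin F (Set.range (matrixAct μ ξ))) := by
    rw [Algebra.adjoin_range_eq_range_aeval,
      Literature.RingTheory.KrullDimension.trdeg_eq_toNat F φ.range]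
    exact_mod_cast (WithBot.coe_le_coe.1 hF |> ENat.coe_le_coe.1)
  obtain ⟨j, hj⟩ := exists_algebraicIndependent_of_le_trdeg (F := F) (matrixAct μ ξ) hr'
  -- the same coordinates are `M`-algebraically independent
  have hjM : AlgebraicIndependent M fun k => aeval (matrixAct μ ξ)
      (X (j k) : MvPolynomial (Fin n ⊕ Fin n) M) := by
    simp only [aeval_X]
    exact hj.restrictScalars (algebraMap M F).injective
  exact le_zariskiDim_image_matrixAct' (contract (M := M) P) hξM hneM μ (fun k => X (j k)) hjM

end Rotund

end Literature.NumberTheory.Transcendental.ChartTransfer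

end
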